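import Summits.Ventures.KdS.RouteWEulerRL
import Summits.Ventures.KdS.ClosedHalfPlane310
import HarnessLib

/-!
# Venture KdS — ROUTE W REBIND: the displayed theorems with NO cited fact on the open half-plane

HONEST FRAMING (venture `Summits/Ventures/KdS`, cell `pub-kds`). The substrate theorems
(`ModeStability.lean`, `Rebind310.lean`) derive Statement A — "off the census window, `Im ω > 0`,
there is no non-trivial generic-boundary mode" — from the WINDOW STATEMENT "every non-trivial mode
with `Im ω > 0` has `0 < |ω| < |m| Ω_SR`", which they import as cited facts: H1′
(`CasalsTeixeiraDaCosta2022_theorem310`, bullet 1, off the threshold rays) and H3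
(`CasalsTeixeiraDaCosta2022_partialModeStabilityProp38`, on the cosmological ray). Route W proves
that window statement OUTRIGHT for every spin `s < 1` (`RouteW.window_lt_one`, from
`RouteW.radial_vanishing_lt_one`: Transfer + the Euler/Riemann–Liouville transform off resonance +
gauge glue + the energy identity of CTdC's Step 2, all theorems of this tree), the only inputs being
subextremality, `0 ≤ a`, `Im ω > 0`, the angular sign `Im(λ̄ω̄) ≤ 0` (H2, proved:
`CasalsTeixeiraDaCosta2022_angularSign_holds`) and `κ₁ ≤ κ₀` (part of the kernel-checked window
constants H4). Hence the `_routeW` TWINS below of the displayed theorems for BOTH columns (`s = −2`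
and the scalar `s = 0`): same conclusions, with the binders `h1`/`h3` DELETED on the open upper
half-plane; on the closed half-plane H1′ is kept for the real axis `Im ω = 0` only (route W is an
`Im ω > 0` argument) and H3 disappears.

What this is NOT: a claim about `s ≥ 1`, about `Im ω = 0` without H1′, or about the certificates
(DATA binders unchanged). Namespace `Summit.Ventures.KdS`; no new definitions, no facts, 0 sorries.

References: Casals–Teixeira da Costa, Commun. Math. Phys. 394 (2022) 797–832
[CasalsTeixeiradacosta2022] Thm 3.10, Prop. 3.8; K. Takemura, J. Math. Soc. Japan 69 (2017) 849–891
[Takemura2017] Prop. 1.2.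
-/

noncomputable section

open Set Complex

namespace Summit.Ventures.KdS

open Literature.Geometry.Lorentzian Literature.Geometry.Lorentzian.KerrDeSitter

/-! ### The window statement for `s < 1`, proved -/

/-- **THE WINDOW STATEMENT FOR SPINS `s < 1`, PROVED (no cited fact).** For subextremal
Kerr–de Sitter parameters with `0 ≤ a` and `κ₁ ≤ κ₀`, every NON-TRIVIAL generic-boundary radial
Teukolsky mode of spin `s < 1` with `Im ω > 0` and `Im(λ̄ω̄) ≤ 0` has `0 < |ω| < |m| Ω_SR` — on and
off the threshold rays alike. (CTdC's pair condition on `m₁ + m₃` is automatic for `κ₁ ≤ κ₀`,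
`pairCondition_eventCauchy`.) -/
theorem RouteW.window_lt_one {M a Λ s : ℝ} {ω : ℂ} {m : ℝ} {lam : ℂ} {R : ℝ → ℂ}
    (hsub : IsSubextremal M a Λ) (ha : 0 ≤ a) (hs : s < 1) (hω : 0 < ω.im)
    (hlam : (lambdaBar a Λ s ω m lam * (starRingEnd ℂ) ω).im ≤ 0)
    (hle : surfaceGravity M a Λ (rPlus M a Λ) ≤ surfaceGravity M a Λ (rMinus M a Λ))
    (hR : IsRadialTeukolskySolution M a Λ s ω m lam R) (hin : IsIngoingAtEventHorizon M a Λ s ω m R)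
    (hout : IsOutgoingAtCosmoHorizon M a Λ ω m R)
    (hnt : ∃ r ∈ Ioo (rPlus M a Λ) (rCosmo M a Λ), R r ≠ 0) :
    0 < ‖ω‖ ∧ ‖ω‖ < |m| * superradiantUpper M a Λ := by
  by_contra hSR
  obtain ⟨r, hr, hne⟩ := hnt
  exact hne (RouteW.radial_vanishing_lt_one hsub ha hs hω hlam hSR
    (pairCondition_eventCauchy (surfaceGravity_rPlus_pos hsub) hle hω.le) hR hin hout r hr)

/-! ### Statement A for both columns, from route W -/

/-- COVERAGE for `s = -2` with NO cited fact: from the window constants (H4) alone (the angular sign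
H2 is `CasalsTeixeiraDaCosta2022_angularSign_holds`, the window statement is `RouteW.window_lt_one`).
Body = `statementA_ofWindow` with both ray cases handled by route W. -/
theorem statementA_routeW {B : Set (ℝ × ℝ × ℝ)} {T : WindowTable} (h4 : WindowConstants B T) :
    StatementA B T := by
  intro p hp ω m hq hk hmode
  obtain ⟨hIm, hm2, hnotW⟩ := hq
  obtain ⟨lam, R, hang, hrad, hin, hout, hnt⟩ := hmode
  obtain ⟨hsub, hapos, haL, haL2, ⟨hk0, hk1, hk2pos, hk10⟩, hkap, hconst⟩ := h4 p hp
  obtain ⟨hΩ, hΩH, hϖ⟩ := hconst m hm2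
  have ha : 0 ≤ p.2.1 := hapos.le
  have hs : ∃ k : ℤ, 2 * (-2 : ℝ) = k := ⟨-4, by norm_num⟩
  have hlam := (CasalsTeixeiraDaCosta2022_angularSign_holds _ _ _ _ _ _ hsub.2.1 hapos hs hk hIm hang).le
  have hnotW' : |ω.re| ≤ T.R m → T.H < ω.im := by
    intro hre
    by_contra hle
    exact hnotW ⟨hre, hIm, not_lt.mp hle⟩
  have hbig : |m| * superradiantUpper p.1 p.2.1 p.2.2 ≤ ‖ω‖ := by
    by_cases hre : |ω.re| ≤ T.R m
    · calc |m| * superradiantUpper p.1 p.2.1 p.2.2 ≤ T.H := hΩH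
        _ ≤ ω.im := le_of_lt (hnotW' hre)
        _ ≤ |ω.im| := le_abs_self _
        _ ≤ ‖ω‖ := Complex.abs_im_le_norm ω
    · calc |m| * superradiantUpper p.1 p.2.1 p.2.2 ≤ T.R m := hΩ
        _ ≤ |ω.re| := le_of_lt (not_le.mp hre)
        _ ≤ ‖ω‖ := Complex.abs_re_le_norm ω
  have hw := RouteW.window_lt_one hsub ha (by norm_num : (-2 : ℝ) < 1) hIm hlam hk10 hrad hin hout hnt
  exact absurd hw.2 (not_lt.mpr hbig)

/-- COVERAGE, scalar column (`s = 0`, `μ = 1`), with NO cited fact: from (H4), (H4s). Body =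
`statementAScalar_ofWindow` with the window statement supplied by `RouteW.window_lt_one`. -/
theorem statementAScalar_routeW {B : Set (ℝ × ℝ × ℝ)} {T : WindowTable} (h4 : WindowConstants B T)
    (h4s : WindowConstantsScalar B T) : StatementAScalar B T := by
  intro p hp ω m hq hk hmode
  obtain ⟨hIm, hm2, hnotW⟩ := hq
  obtain ⟨lam, R, hang, hrad, hin, hout, hnt⟩ := hmode
  obtain ⟨hsub, hapos, haL, haL2, ⟨_hk0, _hk1, _hk2pos, hk10⟩, _hkap, hconst⟩ := h4 p hp
  obtain ⟨hΩ, _hΩH, _hϖ⟩ := hconst m hm2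
  have ha : 0 ≤ p.2.1 := hapos.le
  have hs : ∃ k : ℤ, 2 * (0 : ℝ) = k := ⟨0, by norm_num⟩
  have hlam := (CasalsTeixeiraDaCosta2022_angularSign_holds _ _ _ _ _ _ hsub.2.1 hapos hs hk hIm hang).le
  have hw := RouteW.window_lt_one hsub ha (by norm_num : (0 : ℝ) < 1) hIm hlam hk10 hrad hin hout hnt
  by_cases hm0 : m = 0
  · have h0 : ‖ω‖ < 0 := by simpa [hm0] using hw.2
    exact (not_lt.mpr (norm_nonneg ω)) h0
  · have hh := h4s p hp m hm2 hm0
    have hnotW' : |ω.re| ≤ T.R m → T.h0 m < ω.im := by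
      intro hre
      by_contra hle
      exact hnotW ⟨hm0, hre, hIm, not_lt.mp hle⟩
    have hbig : |m| * superradiantUpper p.1 p.2.1 p.2.2 ≤ ‖ω‖ := by
      by_cases hre : |ω.re| ≤ T.R m
      · calc |m| * superradiantUpper p.1 p.2.1 p.2.2 ≤ T.h0 m := hh
          _ ≤ ω.im := le_of_lt (hnotW' hre)
          _ ≤ |ω.im| := le_abs_self _
          _ ≤ ‖ω‖ := Complex.abs_im_le_norm ω
      · calc |m| * superradiantUpper p.1 p.2.1 p.2.2 ≤ T.R m := hΩ
          _ ≤ |ω.re| := le_of_lt (not_le.mp hre)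
          _ ≤ ‖ω‖ := Complex.abs_re_le_norm ω
    exact absurd hw.2 (not_lt.mpr hbig)

/-! ### `ModeStability.lean` twins with no cited fact -/

/-- MS_trunc (`s = -2`) from the window constants and the certificates' Statement B — no cited fact. -/
theorem msTrunc_routeW {B : Set (ℝ × ℝ × ℝ)} {T : WindowTable} {Λs : ℝ → ℝ → ℂ → ℝ → Set ℂ}
    (h4 : WindowConstants B T) (hB : StatementB B T Λs) : MSTrunc B T Λs :=
  msTrunc_of (statementA_routeW h4) hB

/-- Scalar MS_trunc (`s = 0`, `μ = 1`) from (H4), (H4s) and Statement B — no cited fact. -/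
theorem msTruncScalar_routeW {B : Set (ℝ × ℝ × ℝ)} {T : WindowTable}
    {Λs : ℝ → ℝ → ℂ → ℝ → Set ℂ} (h4 : WindowConstants B T) (h4s : WindowConstantsScalar B T)
    (hB : StatementBScalar B T Λs) : MSTruncScalar B T Λs :=
  msTruncScalar_of (statementAScalar_routeW h4 h4s) hB

/-! ### `ModeStabilityB0.lean` / `WindowConstantsB0.lean` twins -/

/-- The B0 box theorem from rung R2 and rung R3 alone — no cited fact. -/
theorem b0Theorem_routeW (hR2 : R2_WindowConstantsB0) (hR3 : R3_B0Certificates) : B0Theorem :=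
  ⟨msTrunc_routeW hR2.1 (statementB_of_bar (by norm_num) hR3.1),
    msTruncScalar_routeW hR2.1 hR2.2 (statementBScalar_of_bar (by norm_num) hR3.2)⟩

/-- `msTruncB0_tubes` with no cited fact (eng-1's tube records, `s = -2`). -/
theorem msTruncB0_tubes_routeW (lamHat : ℕ → ℂ → ℝ → ℝ → ℂ) (h4 : WindowConstants B0 tableB0)
    (hB : StatementB B0 tableB0 (tubesB0 lamHat)) : MSTrunc B0 tableB0 (tubesB0 lamHat) :=
  msTrunc_routeW h4 hB

/-- **THE B0 BOX THEOREM FROM THE CERTIFICATES ALONE** (open upper half-plane): `B0Theorem` follows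
from the signed certificates R3 and the kernel-checked window constants — NO cited fact. -/
theorem b0Theorem_of_certificates_routeW (hR3 : R3_B0Certificates) : B0Theorem :=
  b0Theorem_routeW r2_windowConstantsB0 hR3

/-! ### `AtlasWave1.lean` twins -/

section Wave

variable {ts : List CertTile}

/-- MS_trunc (`s = -2`) on every tile of a wave — no cited fact. -/
theorem msTrunc_atlas_routeW (hWC : ∀ t ∈ ts, WindowConstants t.tile.box t.T)
    (hη : ∀ t ∈ ts, 0 ≤ t.eta) (hdata : ∀ t ∈ ts, t.Data) :
    ∀ t ∈ ts, MSTrunc t.tile.box t.T t.lam :=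
  fun t ht => msTrunc_routeW (hWC t ht) (statementB_of_bar (hη t ht) (t.statementBbar (hdata t ht)))

/-- Scalar MS_trunc (`s = 0`, `μ = 1`) on every tile — no cited fact. -/
theorem msTruncScalar_atlas_routeW (hWC : ∀ t ∈ ts, WindowConstants t.tile.box t.T)
    (hWCs : ∀ t ∈ ts, WindowConstantsScalar t.tile.box t.T) (hη : ∀ t ∈ ts, 0 ≤ t.eta)
    (hdata : ∀ t ∈ ts, t.DataScalar) :
    ∀ t ∈ ts, MSTruncScalar t.tile.box t.T t.lamScalar :=
  fun t ht => msTruncScalar_routeW (hWC t ht) (hWCs t ht)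
    (statementBScalar_of_bar (hη t ht) (t.statementBbarScalar (hdata t ht)))

/-- **The displayed wave theorem, pointwise form (`s = -2`), with NO cited fact.** For every
parameter point of the atlas there is a tile of the list containing it on which every mode with
`Im ω > 0`, `|m| ≤ 2` has `ω` in the tile's window `W(m)` only if its separation constant lies
outside the tile's (symmetrised) λ-family — given ONLY the kernel-checked window constants and the
certificates' DATA. Twin of `noMode_atlas_310` with `h1`, `h3` deleted. -/
theorem noMode_atlas_routeW (hWC : ∀ t ∈ ts, WindowConstants t.tile.box t.T)
    (hη : ∀ t ∈ ts, 0 ≤ t.eta) (hdata : ∀ t ∈ ts, t.Data) :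
    ∀ p ∈ atlas ts, ∃ t ∈ ts, p ∈ t.tile.box ∧
      NoModeWith p.1 p.2.1 p.2.2 (-2) {q | 0 < q.1.im ∧ |q.2| ≤ 2}
        (fun ω m => {lam | ω ∈ window t.T m → lam ∈ t.lam p.2.1 p.2.2 ω m}) := by
  rintro p ⟨t, ht, hp⟩
  exact ⟨t, ht, hp, msTrunc_atlas_routeW hWC hη hdata t ht p hp⟩

end Wave

/-! ### Closed half-plane: H1′ for the real axis only, H3 gone -/

/-- `s = -2`, closed half-plane: from the corrected fact H1′ ON THE REAL AXIS ONLY, the window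
constants and the records' Statement B̄. Twin of `msTruncClosed_of_facts'_310` with `h3` deleted. -/
theorem msTruncClosed_routeW {B : Set (ℝ × ℝ × ℝ)} {T : WindowTable} {η : ℝ}
    {Λs : ℝ → ℝ → ℂ → ℝ → Set ℂ} (h1 : CasalsTeixeiraDaCosta2022_theorem310)
    (h4 : WindowConstants B T) (hη : 0 ≤ η) (hB : StatementBbar B T η Λs) : MSTruncClosed B T Λs :=
  msTruncClosed_ofA_310 h1 (statementA_routeW h4) h4 hη hB

-- (The scalar closed-half-plane statement never used H3: it is `msTruncClosedScalar_of_facts'_310`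
-- verbatim, so no `_routeW` twin is declared for it.)

/-- B0, closed half-plane: `B0TheoremClosed` from H1′ (real axis only) and the signed records R3. -/
theorem b0TheoremClosed_routeW (h1 : CasalsTeixeiraDaCosta2022_theorem310)
    (hR3 : R3_B0Certificates) : B0TheoremClosed :=
  b0TheoremClosed_ofA_310 h1 (statementA_routeW r2_windowConstantsB0.1)
    (statementAScalar_routeW r2_windowConstantsB0.1 r2_windowConstantsB0.2) hR3

section WaveClosed

variable {ts : List CertTile}

/-- MS_trunc on the closed half-plane (`s = -2`) on every tile: H1′ for the real axis only. -/
theorem msTruncClosed_atlas_routeW (h1 : CasalsTeixeiraDaCosta2022_theorem310)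
    (hWC : ∀ t ∈ ts, WindowConstants t.tile.box t.T) (hη : ∀ t ∈ ts, 0 ≤ t.eta)
    (hdata : ∀ t ∈ ts, t.Data) : ∀ t ∈ ts, MSTruncClosed t.tile.box t.T t.lam :=
  msTruncClosed_atlas_ofA_310 h1 (fun t ht => statementA_routeW (hWC t ht)) hWC hη hdata

/-- The displayed wave theorem on the closed half-plane (`s = -2`): H1′ for the real axis only,
H3 gone. -/
theorem noModeClosed_atlas_routeW (h1 : CasalsTeixeiraDaCosta2022_theorem310)
    (hWC : ∀ t ∈ ts, WindowConstants t.tile.box t.T) (hη : ∀ t ∈ ts, 0 ≤ t.eta)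
    (hdata : ∀ t ∈ ts, t.Data) :
    ∀ p ∈ atlas ts, ∃ t ∈ ts, p ∈ t.tile.box ∧
      NoModeWith p.1 p.2.1 p.2.2 (-2) {q | 0 ≤ q.1.im ∧ |q.2| ≤ 2}
        (fun ω m => {lam | ω ∈ windowClosed t.T m → lam ∈ t.lam p.2.1 p.2.2 ω m}) :=
  noModeClosed_atlas_ofA_310 h1 (fun t ht => statementA_routeW (hWC t ht)) hWC hη hdata

end WaveClosed

end Summit.Ventures.KdS
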